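import Summits.Ventures.LatticeQCDFlow.Scoring.U1PlaquetteCharFunPowLimit
import HarnessLib

/-!
# The continuum limit of the topological susceptibility of 2-d `U(1)`: the normalised terms

HONEST FRAMING: exact (Metropolis-corrected) sampling algorithms for lattice gauge theory;
figures of merit are autocorrelation/cost numbers at stated couplings and volumes; no
continuum-physics claim.

Venture `LatticeQCDFlow` (cell pub-lqcd), sub-topic `Scoring`; FANOUT row 5 (`s0-sun-a`), GEN-15.
NEW WORK of the cell (placement rule).  `Scoring/U1TorusTopologicalSusceptibilityBessel.lean` gives
theory-2's `⟨Q²⟩_{(ℤ/L)²,β} = (V/(16π⁴))·Σ_n[2π I_{|n|}^{V−1} C_n − (V−1) I_{|n|}^{V−2} S_n²]/Σ_n I_{|n|}^V`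
(`V = L²`, `C_n = ∫ v² cos(nv) e^{β cos v}`, `S_n = ∫ v sin(nv) e^{β cos v}`).  Normalised by
`Z = 2π I₀` this reads `⟨Q²⟩ = (1/4π²)·Σ_n T_n / Σ_n r_n^V` with `r_n = I_{|n|}/I₀` and
`T_n = V r_n^{V−1}⟨v² cos nv⟩_β − V(V−1) r_n^{V−2}⟨v sin nv⟩_β²`.  Along `β_j → ∞`, `L_j²/β_j → v > 0`:
`V⟨v² cos nv⟩ → v`, `V⟨v sin nv⟩ → n v` (second/fourth-moment laws of
`Scoring/U1PlaquetteCharFunPowLimit.lean`), `r_n^{V−1}, r_n^{V−2} → e^{−vn²/2}`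
(`Scoring/BesselIRatioPowerLimit.lean`).  This file proves the moment comparisons
(`|⟨v² cos nv⟩ − ⟨v²⟩| ≤ n²⟨v⁴⟩/2`, `|⟨v sin nv⟩ − n⟨v²⟩| ≤ |n|³⟨v⁴⟩/6`, `|⟨v sin nv⟩| ≤ |n|⟨v²⟩`),
the limits `V⟨v² cos nv⟩ → v`, `V⟨v sin nv⟩ → nv`, `⟨v sin nv⟩ → 0`, the shifted power limits, and
**`tendsto_topSusc_term`** — `T_n(j) → (v − v²n²) e^{−vn²/2}`.  The dominated-convergence assembly
`⟨Q²⟩_{L_j,β_j} → (1/(4π²))·Σ_n (v − v²n²) e^{−vn²/2}/Σ_n e^{−vn²/2}` is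
`Scoring/U1TorusTopSusceptibilityContinuumLimit.lean`.

Elementary given the parents; nothing is cited.  No sampler values.
-/

noncomputable section

open Real Filter Topology Set MeasureTheory intervalIntegral
open scoped ENNReal
open Literature.Analysis.FunctionSpaces

namespace Summit.Ventures.LatticeQCDFlow.Scoring

/-! ### 1. The two trigonometric moments against `⟨v²⟩` and `⟨v⁴⟩` -/

/-- `|v (sin(nv) − nv)| ≤ (|n|³/6) v⁴` for all real `n, v` (from `x − x³/6 ≤ sin x ≤ x` for `x ≥ 0`). -/
theorem abs_mul_sin_sub_le (n v : ℝ) : |v * (Real.sin (n * v) - n * v)| ≤ |n| ^ 3 / 6 * v ^ 4 := by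
  -- `|sin x − x| ≤ |x|³/6`
  have key : ∀ x : ℝ, |Real.sin x - x| ≤ |x| ^ 3 / 6 := by
    suffices h : ∀ y : ℝ, 0 ≤ y → |Real.sin y - y| ≤ y ^ 3 / 6 by
      intro x
      rcases le_or_gt 0 x with hx | hx
      · rw [abs_of_nonneg hx]; exact h x hx
      · have h' := h (-x) (by linarith)
        rw [Real.sin_neg, show -Real.sin x - -x = -(Real.sin x - x) by ring, abs_neg] at h'
        rw [abs_of_neg hx]
        exact h'
    intro y hy
    rcases hy.eq_or_lt with rfl | hy0
    · simp
    have h1 := Real.sin_le hy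
    have h2 := Real.sin_gt_sub_cube hy0
    rw [abs_of_nonpos (by linarith)]
    linarith
  have h := key (n * v)
  rw [abs_mul] at h
  have hv4 : |v| ^ 4 = v ^ 4 := by rw [← abs_pow]; exact abs_of_nonneg (by positivity)
  rw [abs_mul]
  calc |v| * |Real.sin (n * v) - n * v| ≤ |v| * ((|n| * |v|) ^ 3 / 6) := by gcongr
    _ = |n| ^ 3 / 6 * |v| ^ 4 := by ring
    _ = |n| ^ 3 / 6 * v ^ 4 := by rw [hv4]

/-- `|∫ v² cos(nv) e^{β cos v} − ∫ v² e^{β cos v}| ≤ (n²/2) ∫ v⁴ e^{β cos v}`. -/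
theorem abs_integral_sq_cos_sub_le (β : ℝ) (n : ℤ) :
    |(∫ v in (-π)..π, v ^ 2 * Real.cos (n * v) * Real.exp (β * Real.cos v)) -
        ∫ v in (-π)..π, v ^ 2 * Real.exp (β * Real.cos v)| ≤
      (n : ℝ) ^ 2 / 2 * ∫ v in (-π)..π, v ^ 4 * Real.exp (β * Real.cos v) := by
  have hle : -π ≤ π := by linarith [Real.pi_pos]
  have hc1 : Continuous fun v => v ^ 2 * Real.cos (n * v) * Real.exp (β * Real.cos v) := by fun_prop
  have hc2 : Continuous fun v => v ^ 2 * Real.exp (β * Real.cos v) := by fun_prop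
  rw [← intervalIntegral.integral_sub (hc1.intervalIntegrable _ _) (hc2.intervalIntegrable _ _),
    ← intervalIntegral.integral_const_mul]
  refine (intervalIntegral.abs_integral_le_integral_abs hle).trans ?_
  refine intervalIntegral.integral_mono_on hle ((hc1.sub hc2).abs.intervalIntegrable _ _)
    ((by fun_prop : Continuous fun v => (n : ℝ) ^ 2 / 2 * (v ^ 4 * Real.exp (β * Real.cos v)))
      |>.intervalIntegrable _ _) fun v _ => ?_
  have hw := Real.exp_pos (β * Real.cos v)
  rw [show v ^ 2 * Real.cos (n * v) * Real.exp (β * Real.cos v) - v ^ 2 * Real.exp (β * Real.cos v) =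
    -(v ^ 2 * (1 - Real.cos (n * v)) * Real.exp (β * Real.cos v)) by ring, abs_neg, abs_mul, abs_mul,
    abs_of_pos hw, abs_of_nonneg (sq_nonneg v), abs_of_nonneg (by linarith [Real.cos_le_one (n * v)])]
  have h := two_mul_one_sub_cos_le_sq ((n : ℝ) * v)
  have h' : 1 - Real.cos ((n : ℝ) * v) ≤ ((n : ℝ) * v) ^ 2 / 2 := by linarith
  calc v ^ 2 * (1 - Real.cos ((n : ℝ) * v)) * Real.exp (β * Real.cos v)
      = (1 - Real.cos ((n : ℝ) * v)) * (v ^ 2 * Real.exp (β * Real.cos v)) := by ring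
    _ ≤ ((n : ℝ) * v) ^ 2 / 2 * (v ^ 2 * Real.exp (β * Real.cos v)) :=
        mul_le_mul_of_nonneg_right h' (by positivity)
    _ = (n : ℝ) ^ 2 / 2 * (v ^ 4 * Real.exp (β * Real.cos v)) := by ring

/-- `|∫ v sin(nv) e^{β cos v} − n ∫ v² e^{β cos v}| ≤ (|n|³/6) ∫ v⁴ e^{β cos v}`. -/
theorem abs_integral_id_sin_sub_le (β : ℝ) (n : ℤ) :
    |(∫ v in (-π)..π, v * Real.sin (n * v) * Real.exp (β * Real.cos v)) -
        n * ∫ v in (-π)..π, v ^ 2 * Real.exp (β * Real.cos v)| ≤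
      |(n : ℝ)| ^ 3 / 6 * ∫ v in (-π)..π, v ^ 4 * Real.exp (β * Real.cos v) := by
  have hle : -π ≤ π := by linarith [Real.pi_pos]
  have hc1 : Continuous fun v => v * Real.sin (n * v) * Real.exp (β * Real.cos v) := by fun_prop
  have hc2 : Continuous fun v => (n : ℝ) * (v ^ 2 * Real.exp (β * Real.cos v)) := by fun_prop
  rw [← intervalIntegral.integral_const_mul (n : ℝ), ← intervalIntegral.integral_sub
    (hc1.intervalIntegrable _ _) (hc2.intervalIntegrable _ _), ← intervalIntegral.integral_const_mul]
  refine (intervalIntegral.abs_integral_le_integral_abs hle).trans ?_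
  refine intervalIntegral.integral_mono_on hle ((hc1.sub hc2).abs.intervalIntegrable _ _)
    ((by fun_prop : Continuous fun v => |(n : ℝ)| ^ 3 / 6 * (v ^ 4 * Real.exp (β * Real.cos v)))
      |>.intervalIntegrable _ _) fun v _ => ?_
  have hw := Real.exp_pos (β * Real.cos v)
  rw [show v * Real.sin (n * v) * Real.exp (β * Real.cos v) - n * (v ^ 2 * Real.exp (β * Real.cos v)) =
    v * (Real.sin (n * v) - n * v) * Real.exp (β * Real.cos v) by ring, abs_mul, abs_of_pos hw]
  have h := abs_mul_sin_sub_le (n : ℝ) v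
  calc |v * (Real.sin (n * v) - n * v)| * Real.exp (β * Real.cos v)
      ≤ |(n : ℝ)| ^ 3 / 6 * v ^ 4 * Real.exp (β * Real.cos v) := by gcongr
    _ = |(n : ℝ)| ^ 3 / 6 * (v ^ 4 * Real.exp (β * Real.cos v)) := by ring

/-- `|∫ v sin(nv) e^{β cos v}| ≤ |n| ∫ v² e^{β cos v}` (`|v sin(nv)| ≤ |n| v²`). -/
theorem abs_integral_id_sin_le (β : ℝ) (n : ℤ) :
    |∫ v in (-π)..π, v * Real.sin (n * v) * Real.exp (β * Real.cos v)| ≤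
      |(n : ℝ)| * ∫ v in (-π)..π, v ^ 2 * Real.exp (β * Real.cos v) := by
  have hle : -π ≤ π := by linarith [Real.pi_pos]
  rw [← intervalIntegral.integral_const_mul]
  refine (intervalIntegral.abs_integral_le_integral_abs hle).trans ?_
  refine intervalIntegral.integral_mono_on hle ?_ ?_ fun v _ => ?_
  · exact (by fun_prop : Continuous fun v => |v * Real.sin (n * v) * Real.exp (β * Real.cos v)|)
      |>.intervalIntegrable _ _
  · exact (by fun_prop : Continuous fun v => |(n : ℝ)| * (v ^ 2 * Real.exp (β * Real.cos v)))
      |>.intervalIntegrable _ _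
  · have hw := Real.exp_pos (β * Real.cos v)
    rw [abs_mul, abs_mul, abs_of_pos hw]
    have hs : |Real.sin (n * v)| ≤ |(n : ℝ) * v| := Real.abs_sin_le_abs
    rw [abs_mul] at hs
    calc |v| * |Real.sin (n * v)| * Real.exp (β * Real.cos v)
        ≤ |v| * (|(n : ℝ)| * |v|) * Real.exp (β * Real.cos v) := by gcongr
      _ = |(n : ℝ)| * (v ^ 2 * Real.exp (β * Real.cos v)) := by
          rw [show |v| * (|(n : ℝ)| * |v|) = |(n : ℝ)| * (|v| * |v|) by ring, abs_mul_abs_self]; ring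

/-- `|∫ v² cos(nv) e^{β cos v}| ≤ ∫ v² e^{β cos v}`. -/
theorem abs_integral_sq_cos_le (β : ℝ) (n : ℤ) :
    |∫ v in (-π)..π, v ^ 2 * Real.cos (n * v) * Real.exp (β * Real.cos v)| ≤
      ∫ v in (-π)..π, v ^ 2 * Real.exp (β * Real.cos v) := by
  have hle : -π ≤ π := by linarith [Real.pi_pos]
  refine (intervalIntegral.abs_integral_le_integral_abs hle).trans ?_
  refine intervalIntegral.integral_mono_on hle ?_ ?_ fun v _ => ?_
  · exact (by fun_prop : Continuous fun v => |v ^ 2 * Real.cos (n * v) * Real.exp (β * Real.cos v)|)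
      |>.intervalIntegrable _ _
  · exact (by fun_prop : Continuous fun v => v ^ 2 * Real.exp (β * Real.cos v)).intervalIntegrable _ _
  · rw [abs_mul, abs_mul, abs_of_pos (Real.exp_pos _), abs_of_nonneg (sq_nonneg v)]
    have := Real.abs_cos_le_one ((n : ℝ) * v)
    have hw := (Real.exp_pos (β * Real.cos v)).le
    nlinarith [sq_nonneg v, mul_nonneg (sq_nonneg v) hw]

/-! ### 2. Limits of the normalised moments along a continuum sequence -/

/-- `V_j ⟨v² cos nv⟩_{β_j} → v`. -/
theorem tendsto_mul_sqCosMoment {β : ℕ → ℝ} {V : ℕ → ℕ} {v : ℝ} (hβ : Tendsto β atTop atTop)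
    (hv : Tendsto (fun j => (V j : ℝ) / β j) atTop (𝓝 v)) (n : ℤ) :
    Tendsto (fun j => (V j : ℝ) * ((∫ x in (-π)..π, x ^ 2 * Real.cos (n * x) * Real.exp (β j * Real.cos x)) /
      (∫ x in (-π)..π, Real.exp (β j * Real.cos x)))) atTop (𝓝 v) := by
  have h2 := tendsto_mul_sqMoment hβ hv
  have h4 := tendsto_mul_fourthMoment hβ hv
  have hdiff : Tendsto (fun j => (V j : ℝ) * ((∫ x in (-π)..π, x ^ 2 * Real.cos (n * x) * Real.exp (β j * Real.cos x)) /
      (∫ x in (-π)..π, Real.exp (β j * Real.cos x))) -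
      (V j : ℝ) * ((∫ x in (-π)..π, x ^ 2 * Real.exp (β j * Real.cos x)) /
      (∫ x in (-π)..π, Real.exp (β j * Real.cos x)))) atTop (𝓝 0) := by
    refine squeeze_zero_norm' (Eventually.of_forall fun j => ?_) (by simpa using h4.const_mul ((n : ℝ) ^ 2 / 2))
    have hZ := integral_exp_mul_cos_neg_pi_pi_pos (β j)
    have h := abs_integral_sq_cos_sub_le (β j) n
    rw [Real.norm_eq_abs, ← mul_sub, ← sub_div, abs_mul, abs_of_nonneg (by positivity : (0 : ℝ) ≤ V j),
      abs_div, abs_of_pos hZ]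
    calc (V j : ℝ) * (|(∫ x in (-π)..π, x ^ 2 * Real.cos (n * x) * Real.exp (β j * Real.cos x)) -
          ∫ x in (-π)..π, x ^ 2 * Real.exp (β j * Real.cos x)| / ∫ x in (-π)..π, Real.exp (β j * Real.cos x))
        ≤ (V j : ℝ) * ((n : ℝ) ^ 2 / 2 * (∫ x in (-π)..π, x ^ 4 * Real.exp (β j * Real.cos x)) /
          ∫ x in (-π)..π, Real.exp (β j * Real.cos x)) := by gcongr
      _ = _ := by ring
  have := h2.add hdiff
  rw [add_zero] at this
  exact this.congr fun j => by ring

/-- `V_j ⟨v sin nv⟩_{β_j} → n v`. -/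
theorem tendsto_mul_idSinMoment {β : ℕ → ℝ} {V : ℕ → ℕ} {v : ℝ} (hβ : Tendsto β atTop atTop)
    (hv : Tendsto (fun j => (V j : ℝ) / β j) atTop (𝓝 v)) (n : ℤ) :
    Tendsto (fun j => (V j : ℝ) * ((∫ x in (-π)..π, x * Real.sin (n * x) * Real.exp (β j * Real.cos x)) /
      (∫ x in (-π)..π, Real.exp (β j * Real.cos x)))) atTop (𝓝 ((n : ℝ) * v)) := by
  have h2 := (tendsto_mul_sqMoment hβ hv).const_mul (n : ℝ)
  have h4 := tendsto_mul_fourthMoment hβ hv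
  have hdiff : Tendsto (fun j => (V j : ℝ) * ((∫ x in (-π)..π, x * Real.sin (n * x) * Real.exp (β j * Real.cos x)) /
      (∫ x in (-π)..π, Real.exp (β j * Real.cos x))) -
      (n : ℝ) * ((V j : ℝ) * ((∫ x in (-π)..π, x ^ 2 * Real.exp (β j * Real.cos x)) /
      (∫ x in (-π)..π, Real.exp (β j * Real.cos x))))) atTop (𝓝 0) := by
    refine squeeze_zero_norm' (Eventually.of_forall fun j => ?_) (by simpa using h4.const_mul (|(n : ℝ)| ^ 3 / 6))
    have hZ := integral_exp_mul_cos_neg_pi_pi_pos (β j)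
    have h := abs_integral_id_sin_sub_le (β j) n
    have e : (V j : ℝ) * ((∫ x in (-π)..π, x * Real.sin (n * x) * Real.exp (β j * Real.cos x)) /
        (∫ x in (-π)..π, Real.exp (β j * Real.cos x))) -
        (n : ℝ) * ((V j : ℝ) * ((∫ x in (-π)..π, x ^ 2 * Real.exp (β j * Real.cos x)) /
        (∫ x in (-π)..π, Real.exp (β j * Real.cos x)))) =
        (V j : ℝ) * (((∫ x in (-π)..π, x * Real.sin (n * x) * Real.exp (β j * Real.cos x)) -
          n * ∫ x in (-π)..π, x ^ 2 * Real.exp (β j * Real.cos x)) /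
          ∫ x in (-π)..π, Real.exp (β j * Real.cos x)) := by ring
    rw [Real.norm_eq_abs, e, abs_mul, abs_of_nonneg (by positivity : (0 : ℝ) ≤ V j), abs_div, abs_of_pos hZ]
    calc (V j : ℝ) * (|(∫ x in (-π)..π, x * Real.sin (n * x) * Real.exp (β j * Real.cos x)) -
          n * ∫ x in (-π)..π, x ^ 2 * Real.exp (β j * Real.cos x)| / ∫ x in (-π)..π, Real.exp (β j * Real.cos x))
        ≤ (V j : ℝ) * (|(n : ℝ)| ^ 3 / 6 * (∫ x in (-π)..π, x ^ 4 * Real.exp (β j * Real.cos x)) /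
          ∫ x in (-π)..π, Real.exp (β j * Real.cos x)) := by gcongr
      _ = _ := by ring
  have := h2.add hdiff
  rw [add_zero] at this
  exact this.congr fun j => by ring

/-- `⟨v sin nv⟩_{β_j} → 0`. -/
theorem tendsto_idSinMoment_zero {β : ℕ → ℝ} (hβ : Tendsto β atTop atTop) (n : ℤ) :
    Tendsto (fun j => (∫ x in (-π)..π, x * Real.sin (n * x) * Real.exp (β j * Real.cos x)) /
      (∫ x in (-π)..π, Real.exp (β j * Real.cos x))) atTop (𝓝 0) := by
  have h2 := tendsto_sqMoment_zero hβ
  refine squeeze_zero_norm' (Eventually.of_forall fun j => ?_) (by simpa using h2.const_mul |(n : ℝ)|)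
  have hZ := integral_exp_mul_cos_neg_pi_pi_pos (β j)
  rw [Real.norm_eq_abs, abs_div, abs_of_pos hZ, ← mul_div_assoc]
  exact div_le_div_of_nonneg_right (abs_integral_id_sin_le (β j) n) hZ.le

/-- The Bessel-ratio powers with shifted exponents: `(I_{|n|}(β_j)/I₀(β_j))^{V_j − d} → e^{−vn²/2}`. -/
theorem tendsto_besselI_natAbs_ratio_pow_sub {β : ℕ → ℝ} {V : ℕ → ℕ} {v : ℝ} (hβ : Tendsto β atTop atTop)
    (hv : Tendsto (fun j => (V j : ℝ) / β j) atTop (𝓝 v)) (d : ℕ) (hVd : ∀ᶠ j in atTop, d ≤ V j) (n : ℤ) :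
    Tendsto (fun j => (besselI n.natAbs (β j) / besselI 0 (β j)) ^ (V j - d)) atTop
      (𝓝 (Real.exp (-(v * (n : ℝ) ^ 2 / 2)))) := by
  have hv' : Tendsto (fun j => ((V j - d : ℕ) : ℝ) / β j) atTop (𝓝 v) := by
    have h := hv.sub ((tendsto_inv_atTop_zero.comp hβ).const_mul (d : ℝ))
    rw [mul_zero, sub_zero] at h
    refine h.congr' ?_
    filter_upwards [hVd] with j hj
    rw [Nat.cast_sub hj, sub_div]
    simp [div_eq_mul_inv]
  have h := tendsto_besselI_ratio_pow hβ hv' 0 n.natAbs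
  have e : v * ((n.natAbs : ℝ) * (2 * ((0 : ℕ) : ℝ) + (n.natAbs : ℝ)) / 2) = v * (n : ℝ) ^ 2 / 2 := by
    rw [Nat.cast_zero, mul_zero, zero_add, Nat.cast_natAbs, Int.cast_abs, abs_mul_abs_self]; ring
  simpa only [zero_add, e] using h

/-! ### 3. The normalised terms: limit and domination -/

/-- **Termwise limit**: `T_n(j) = V r_n^{V−1}⟨v² cos nv⟩ − V(V−1) r_n^{V−2}⟨v sin nv⟩² → (v − v²n²) e^{−vn²/2}`. -/
theorem tendsto_topSusc_term {β : ℕ → ℝ} {V : ℕ → ℕ} {v : ℝ} (hβ : Tendsto β atTop atTop)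
    (hv : Tendsto (fun j => (V j : ℝ) / β j) atTop (𝓝 v)) (hV2 : ∀ᶠ j in atTop, 2 ≤ V j) (n : ℤ) :
    Tendsto (fun j => (V j : ℝ) * (besselI n.natAbs (β j) / besselI 0 (β j)) ^ (V j - 1) *
        ((∫ x in (-π)..π, x ^ 2 * Real.cos (n * x) * Real.exp (β j * Real.cos x)) /
          (∫ x in (-π)..π, Real.exp (β j * Real.cos x))) -
      (V j : ℝ) * ((V j - 1 : ℕ) : ℝ) * (besselI n.natAbs (β j) / besselI 0 (β j)) ^ (V j - 2) *
        ((∫ x in (-π)..π, x * Real.sin (n * x) * Real.exp (β j * Real.cos x)) /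
          (∫ x in (-π)..π, Real.exp (β j * Real.cos x))) ^ 2) atTop
      (𝓝 ((v - v ^ 2 * (n : ℝ) ^ 2) * Real.exp (-(v * (n : ℝ) ^ 2 / 2)))) := by
  have hV1 : ∀ᶠ j in atTop, 1 ≤ V j := hV2.mono fun j hj => by omega
  have hr1 := tendsto_besselI_natAbs_ratio_pow_sub hβ hv 1 hV1 n
  have hr2 := tendsto_besselI_natAbs_ratio_pow_sub hβ hv 2 hV2 n
  have hC := tendsto_mul_sqCosMoment hβ hv n
  have hS := tendsto_mul_idSinMoment hβ hv n
  have hS0 := tendsto_idSinMoment_zero hβ n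
  -- `(V−1) m_S = V m_S − m_S → n v`
  have hS' : Tendsto (fun j => ((V j - 1 : ℕ) : ℝ) *
      ((∫ x in (-π)..π, x * Real.sin (n * x) * Real.exp (β j * Real.cos x)) /
        (∫ x in (-π)..π, Real.exp (β j * Real.cos x)))) atTop (𝓝 ((n : ℝ) * v)) := by
    have h := hS.sub hS0
    rw [sub_zero] at h
    refine h.congr' ?_
    filter_upwards [hV1] with j hj
    rw [Nat.cast_sub hj]; push_cast; ring
  have h1 : Tendsto (fun j => (V j : ℝ) * (besselI n.natAbs (β j) / besselI 0 (β j)) ^ (V j - 1) *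
      ((∫ x in (-π)..π, x ^ 2 * Real.cos (n * x) * Real.exp (β j * Real.cos x)) /
        (∫ x in (-π)..π, Real.exp (β j * Real.cos x)))) atTop (𝓝 (v * Real.exp (-(v * (n : ℝ) ^ 2 / 2)))) := by
    have := hC.mul hr1
    refine (this.congr fun j => by ring).trans ?_
    rw [mul_comm]
  have h2 : Tendsto (fun j => (V j : ℝ) * ((V j - 1 : ℕ) : ℝ) * (besselI n.natAbs (β j) / besselI 0 (β j)) ^ (V j - 2) *
      ((∫ x in (-π)..π, x * Real.sin (n * x) * Real.exp (β j * Real.cos x)) /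
        (∫ x in (-π)..π, Real.exp (β j * Real.cos x))) ^ 2) atTop
      (𝓝 (((n : ℝ) * v) * ((n : ℝ) * v) * Real.exp (-(v * (n : ℝ) ^ 2 / 2)))) := by
    have := (hS.mul hS').mul hr2
    exact this.congr fun j => by ring
  have := h1.sub h2
  refine (this.congr fun j => rfl).trans ?_
  rw [show v * Real.exp (-(v * (n : ℝ) ^ 2 / 2)) - (n : ℝ) * v * ((n : ℝ) * v) * Real.exp (-(v * (n : ℝ) ^ 2 / 2)) =
    (v - v ^ 2 * (n : ℝ) ^ 2) * Real.exp (-(v * (n : ℝ) ^ 2 / 2)) by ring]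

end Summit.Ventures.LatticeQCDFlow.Scoring
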